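import Literature.Probability.Process.AlmostContinuousMapping
import HarnessLib

/-!
# The extended almost-continuous mapping theorem (maps varying with `n`, continuity along good sequences)

Topic `Literature/Probability/Process` (generic weak-convergence tools; theorems only, no
definition, no named fact). Sequel of `AlmostContinuousMapping.lean`.

When lattice curves `γ_n` in approximating domains `(Ω_n; a_n, b_n) → (Ω; a, b)` are compared
with their scaling limit, the functional applied to `γ_n` depends on `n` — Kemppainen–Smirnov
(Ann. Probab. 45 (2017)) transport each `γ_n` by ITS OWN conformal map `φ_n : Ω_n → 𝔻` ("a
collection `Σ` of pairs `(φ, P)`", §1.1) before taking driving terms, and handle `Ω_n → Ω` in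
the Carathéodory sense in Cor. 1.8 (arXiv:1212.6215: proof on pp. 19–20); Chelkak–Duminil-Copin–
Hongler–Kemppainen–Smirnov (C. R. Math. 352 (2014), §3, first lines) "consider a family of
conformal maps `φ^δ` from `Ω^δ` onto `ℍ` … we may assume that `φ^δ → φ` as `δ → 0`, uniformly
on compact subsets". The weak-convergence step behind such statements is the **extended
(generalised) continuous mapping theorem** (Billingsley, *Convergence of Probability Measures*,
2nd ed. (1999), Thm. 2.7 for one map and §"maps varying with n" / van der Vaart–Wellner (1996),
Thm. 1.11.1: if `x_n → x` implies `ψ_n(x_n) → ψ(x)` for `μ`-a.e. `x`, then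
`μ_n ∘ ψ_n⁻¹ ⇒ μ ∘ ψ⁻¹`), here PROVED in the localised form needed for random curves, where the
continuity of `ψ_n → ψ` along sequences is only available for GOOD approximants (curves in
events `K_n` of probability `≥ 1 - ε`, as in KS §3.5) and for a.e. limit point:

* `tendsto_map_of_forall_exists_seq_tendsto` — let `μs n → μ` weakly on a pseudo-emetric space
  `E`, `ψs n`, `ψ : E → F'` a.e.-measurable. Suppose that for every `ε > 0` there are sets
  `K n ⊆ E` with `μs n (K n)ᶜ ≤ ε` eventually such that for `μ`-a.e. `x`: whenever
  `u : ℕ → ℕ` is strictly increasing, `xs j ∈ K (u j)` and `xs j → x`, then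
  `ψs (u j) (xs j) → ψ x`. Then `μs n ∘ (ψs n)⁻¹ → μ ∘ ψ⁻¹` weakly.
  Proof (closed-set portmanteau): for `C` closed and `A_m = closure ⋃_{n ≥ m} ((ψs n)⁻¹ C ∩ K n)`,
  `limsup μs n ((ψs n)⁻¹ C) ≤ μ (A_m) + ε` for every `m`, `μ (A_m) ↓ μ (⋂ A_m)`, and a diagonal
  sequence shows `⋂ A_m ⊆ ψ⁻¹ C ∪ {bad x}`;
* `tendstoInDistribution_comp_of_forall_exists_seq_tendsto`,
  `tendstoInDistribution_prodMk_comp_of_forall_exists_seq_tendsto` — the same for random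
  variables `X n → Z` in distribution, and jointly with `X n`;
* `measure_compl_eq_zero_of_forall_exists_seq_limits`, `ae_mem_of_forall_exists_seq_limits`,
  `ae_mem_of_tendstoInDistribution_of_forall_exists_seq_limits` — **support transfer along
  varying good sets**: if `μs n (K n)ᶜ ≤ ε` eventually and every limit of a good sequence
  (`xs j ∈ K (u j)`, `xs j → x`) lies in `G`, then the weak limit is carried by `G`.

With `ψs n = ψ`, `K n = K` closed and `ContinuousOn ψ K` this is again the almost-continuous
mapping theorem of `AlmostContinuousMapping.lean` (a limit of points of the closed set `K` lies
in `K`).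

## References

* P. Billingsley, *Convergence of Probability Measures*, 2nd ed., Wiley (1999), §2 (the mapping
  theorem) and §6/Problem on maps `h_n → h`. [Billingsley1999]
* A. W. van der Vaart, J. A. Wellner, *Weak Convergence and Empirical Processes*, Springer
  (1996), Thm. 1.11.1 (extended continuous mapping). [vanderVaartWellner1996]
* A. Kemppainen, S. Smirnov, Ann. Probab. 45 (2017) 698–779, §3.5 and Cor. 1.8
  (arXiv:1212.6215, pp. 18–20). [KemppainenSmirnov2017]
-/

noncomputable section

open Set Filter Topology MeasureTheory
open scoped NNReal ENNReal

namespace Literature.Probability.Process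

variable {E : Type*} [MeasurableSpace E] [PseudoEMetricSpace E] [OpensMeasurableSpace E]
  {F' : Type*} [MeasurableSpace F'] [TopologicalSpace F'] [OpensMeasurableSpace F']

omit [MeasurableSpace E] [OpensMeasurableSpace E] in
/-- **A diagonal sequence through a decreasing family of closures.** If `x` lies in the closure
of `⋃_{n ≥ m} S n` for every `m`, then there are a strictly increasing `u : ℕ → ℕ` and points
`xs j ∈ S (u j)` with `xs j → x`. [folklore] -/
theorem exists_strictMono_seq_tendsto_of_forall_mem_closure {S : ℕ → Set E} {x : E}
    (hx : ∀ m, x ∈ closure (⋃ n, ⋃ (_ : m ≤ n), S n)) :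
    ∃ (u : ℕ → ℕ) (xs : ℕ → E), StrictMono u ∧ (∀ j, xs j ∈ S (u j)) ∧
      Tendsto xs atTop (𝓝 x) := by
  haveI : Nonempty E := ⟨x⟩
  have hex : ∀ (m : ℕ) (δ : ℝ≥0∞), 0 < δ → ∃ n, m ≤ n ∧ ∃ y ∈ S n, edist x y < δ := by
    intro m δ hδ
    obtain ⟨y, hy, hxy⟩ := EMetric.mem_closure_iff.1 (hx m) δ hδ
    simp only [mem_iUnion] at hy
    obtain ⟨n, hmn, hyn⟩ := hy
    exact ⟨n, hmn, y, hyn, hxy⟩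
  choose! nxt hnxt y hyS hyd using hex
  -- radii `δ j = (j+1)⁻¹`
  set δ : ℕ → ℝ≥0∞ := fun j ↦ ((j + 1 : ℕ) : ℝ≥0∞)⁻¹ with hδ
  have hδpos : ∀ j, 0 < δ j := fun j ↦ by
    simp only [hδ]
    exact ENNReal.inv_pos.2 (ENNReal.natCast_ne_top _)
  -- the lower bounds `prev j` for the `j`-th index, defined recursively
  set prev : ℕ → ℕ := fun j ↦ Nat.rec 0 (fun i p ↦ nxt p (δ i) + 1) j with hprev
  have hprev_succ : ∀ j, prev (j + 1) = nxt (prev j) (δ j) + 1 := fun j ↦ rfl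
  refine ⟨fun j ↦ nxt (prev j) (δ j), fun j ↦ y (prev j) (δ j), ?_, fun j ↦ hyS _ _ (hδpos j), ?_⟩
  · refine strictMono_nat_of_lt_succ fun j ↦ ?_
    have h1 : prev (j + 1) ≤ nxt (prev (j + 1)) (δ (j + 1)) := hnxt _ _ (hδpos (j + 1))
    rw [hprev_succ] at h1 ⊢
    omega
  · rw [EMetric.tendsto_nhds]
    intro ε hε
    have hδlim : Tendsto δ atTop (𝓝 0) := by
      have h := ENNReal.tendsto_inv_nat_nhds_zero.comp (tendsto_add_atTop_nat 1)
      exact h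
    filter_upwards [(tendsto_order.1 hδlim).2 ε hε] with j hj
    rw [edist_comm]
    exact (hyd _ _ (hδpos j)).trans hj

/-- **The extended almost-continuous mapping theorem.** Let `μs n → μ` weakly on a
pseudo-emetric space and let `ψs n`, `ψ : E → F'` be a.e.-measurable. Suppose that for every
`ε > 0` there are sets `K n` with `μs n (K n)ᶜ ≤ ε` eventually such that, for `μ`-a.e. `x`,
`ψs (u j) (xs j) → ψ x` whenever `u` is strictly increasing, `xs j ∈ K (u j)` for all `j` and
`xs j → x`. Then the image laws converge weakly: `μs n ∘ (ψs n)⁻¹ → μ ∘ ψ⁻¹`.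
(Billingsley's / van der Vaart–Wellner's extended continuous mapping theorem, localised to good
approximants; the form in which driving terms taken through varying conformal maps
`φ_n → φ` pass to the limit, Kemppainen–Smirnov 2017, Cor. 1.8.) [folklore] -/
theorem tendsto_map_of_forall_exists_seq_tendsto
    {μs : ℕ → ProbabilityMeasure E} {μ : ProbabilityMeasure E} (hlim : Tendsto μs atTop (𝓝 μ))
    {ψs : ℕ → E → F'} {ψ : E → F'}
    (hψs : ∀ n, AEMeasurable (ψs n) (μs n : Measure E)) (hψ : AEMeasurable ψ (μ : Measure E))
    (h : ∀ ε : ℝ≥0∞, 0 < ε → ∃ K : ℕ → Set E,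
      (∀ᶠ n in atTop, (μs n : Measure E) (K n)ᶜ ≤ ε) ∧
      ∀ᵐ x ∂(μ : Measure E), ∀ u : ℕ → ℕ, StrictMono u → ∀ xs : ℕ → E,
        (∀ j, xs j ∈ K (u j)) → Tendsto xs atTop (𝓝 x) →
          Tendsto (fun j ↦ ψs (u j) (xs j)) atTop (𝓝 (ψ x))) :
    Tendsto (fun n ↦ (μs n).map (hψs n)) atTop (𝓝 (μ.map hψ)) := by
  refine tendsto_of_forall_isClosed_limsup_le' fun C hC ↦ ?_
  have hrw : ∀ n, (((μs n).map (hψs n) : ProbabilityMeasure F') : Measure F') C =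
      (μs n : Measure E) (ψs n ⁻¹' C) := fun n ↦ by
    rw [ProbabilityMeasure.toMeasure_map, Measure.map_apply_of_aemeasurable (hψs n) hC.measurableSet]
  have hrw' : ((μ.map hψ : ProbabilityMeasure F') : Measure F') C = (μ : Measure E) (ψ ⁻¹' C) := by
    rw [ProbabilityMeasure.toMeasure_map, Measure.map_apply_of_aemeasurable hψ hC.measurableSet]
  simp_rw [hrw, hrw']
  refine ENNReal.le_of_forall_pos_le_add fun ε hε _ ↦ ?_
  obtain ⟨K, hK, hgood⟩ := h ε (by exact_mod_cast hε)
  -- the good parts of the preimages and the closures of their tails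
  set S : ℕ → Set E := fun n ↦ ψs n ⁻¹' C ∩ K n with hS
  set A : ℕ → Set E := fun m ↦ closure (⋃ n, ⋃ (_ : m ≤ n), S n) with hA
  have hAclosed : ∀ m, IsClosed (A m) := fun m ↦ isClosed_closure
  have hSA : ∀ {m n : ℕ}, m ≤ n → S n ⊆ A m := fun {m n} hmn ↦
    (subset_iUnion₂ (s := fun n (_ : m ≤ n) ↦ S n) n hmn).trans subset_closure
  have hAanti : Antitone A := fun m m' hmm' ↦
    closure_mono (iUnion₂_subset fun n hn ↦ subset_iUnion₂ (s := fun n (_ : m ≤ n) ↦ S n) n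
      (hmm'.trans hn))
  -- Step 1: `limsup μs n ((ψs n)⁻¹ C) ≤ μ (A m) + ε` for every `m`
  have h1 : ∀ m, limsup (fun n ↦ (μs n : Measure E) (ψs n ⁻¹' C)) atTop ≤
      (μ : Measure E) (A m) + ε := by
    intro m
    calc limsup (fun n ↦ (μs n : Measure E) (ψs n ⁻¹' C)) atTop
        ≤ limsup (fun n ↦ (μs n : Measure E) (A m) + (ε : ℝ≥0∞)) atTop := by
          refine limsup_le_limsup ?_ (by isBoundedDefault) (by isBoundedDefault)
          filter_upwards [hK, eventually_ge_atTop m] with n hn hmn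
          calc (μs n : Measure E) (ψs n ⁻¹' C)
              ≤ (μs n : Measure E) (K n ∩ ψs n ⁻¹' C) + (μs n : Measure E) (K n)ᶜ :=
                measure_le_measure_inter_add_measure_compl _ _ _
            _ ≤ (μs n : Measure E) (A m) + ε := by
                refine add_le_add (measure_mono ?_) hn
                rw [inter_comm]
                exact hSA hmn
      _ = limsup (fun n ↦ (μs n : Measure E) (A m)) atTop + (ε : ℝ≥0∞) :=
          limsup_add_const _ _ _ (by isBoundedDefault) (by isBoundedDefault)
      _ ≤ (μ : Measure E) (A m) + ε :=
          add_le_add (ProbabilityMeasure.limsup_measure_closed_le_of_tendsto hlim (hAclosed m))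
            le_rfl
  -- Step 2: continuity from above along the decreasing closed sets `A m`
  have h2 : Tendsto (fun m ↦ (μ : Measure E) (A m)) atTop (𝓝 ((μ : Measure E) (⋂ m, A m))) :=
    tendsto_measure_iInter_atTop (fun m ↦ (hAclosed m).measurableSet.nullMeasurableSet) hAanti
      ⟨0, measure_ne_top _ _⟩
  -- Step 3: `⋂ A m ⊆ ψ⁻¹ C ∪ {bad points}` by a diagonal sequence
  have h3 : (μ : Measure E) (⋂ m, A m) ≤ (μ : Measure E) (ψ ⁻¹' C) := by
    set bad : Set E := {x | ¬ ∀ u : ℕ → ℕ, StrictMono u → ∀ xs : ℕ → E,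
      (∀ j, xs j ∈ K (u j)) → Tendsto xs atTop (𝓝 x) →
        Tendsto (fun j ↦ ψs (u j) (xs j)) atTop (𝓝 (ψ x))} with hbad
    have hbad0 : (μ : Measure E) bad = 0 := ae_iff.1 hgood
    have hsub : (⋂ m, A m) ⊆ ψ ⁻¹' C ∪ bad := by
      intro x hx
      by_cases hgx : ∀ u : ℕ → ℕ, StrictMono u → ∀ xs : ℕ → E,
          (∀ j, xs j ∈ K (u j)) → Tendsto xs atTop (𝓝 x) →
            Tendsto (fun j ↦ ψs (u j) (xs j)) atTop (𝓝 (ψ x))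
      · left
        obtain ⟨u, xs, hu, hxs, hxlim⟩ :=
          exists_strictMono_seq_tendsto_of_forall_mem_closure (S := S) (mem_iInter.1 hx)
        have hconv := hgx u hu xs (fun j ↦ (hxs j).2) hxlim
        exact hC.mem_of_tendsto hconv (Eventually.of_forall fun j ↦ (hxs j).1)
      · exact Or.inr hgx
    calc (μ : Measure E) (⋂ m, A m) ≤ (μ : Measure E) (ψ ⁻¹' C ∪ bad) := measure_mono hsub
      _ ≤ (μ : Measure E) (ψ ⁻¹' C) + (μ : Measure E) bad := measure_union_le _ _
      _ = (μ : Measure E) (ψ ⁻¹' C) := by rw [hbad0, add_zero]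
  -- Step 4: conclude
  have h4 : limsup (fun n ↦ (μs n : Measure E) (ψs n ⁻¹' C)) atTop ≤
      (μ : Measure E) (⋂ m, A m) + ε :=
    ge_of_tendsto' (h2.add tendsto_const_nhds) h1
  exact h4.trans (add_le_add h3 le_rfl)

/-! ### Random variables converging in distribution -/

section InDistribution

variable {Ω : ℕ → Type*} {mΩ : ∀ n, MeasurableSpace (Ω n)} {P : ∀ n, Measure (Ω n)}
  [∀ n, IsProbabilityMeasure (P n)] {Ω' : Type*} {mΩ' : MeasurableSpace Ω'} {P' : Measure Ω'}
  [IsProbabilityMeasure P'] {X : ∀ n, Ω n → E} {Z : Ω' → E}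

/-- **The extended almost-continuous mapping theorem for convergence in distribution.** If
`X n → Z` in distribution, `ψs n`, `ψ` are measurable, and for every `ε > 0` there are measurable
sets `K n` with `P n (X n ∉ K n) ≤ ε` eventually such that, for a.e. point `x` of the LAW of `Z`,
`ψs (u j) (xs j) → ψ x` whenever `u` is strictly increasing, `xs j ∈ K (u j)` and `xs j → x`,
then `ψs n (X n) → ψ Z` in distribution. [folklore] -/
theorem tendstoInDistribution_comp_of_forall_exists_seq_tendsto
    (hX : TendstoInDistribution X atTop Z P P') {ψs : ℕ → E → F'} {ψ : E → F'}
    (hψs : ∀ n, Measurable (ψs n)) (hψ : Measurable ψ)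
    (h : ∀ ε : ℝ≥0∞, 0 < ε → ∃ K : ℕ → Set E, (∀ n, MeasurableSet (K n)) ∧
      (∀ᶠ n in atTop, P n (X n ⁻¹' (K n)ᶜ) ≤ ε) ∧
      ∀ᵐ x ∂(P'.map Z), ∀ u : ℕ → ℕ, StrictMono u → ∀ xs : ℕ → E,
        (∀ j, xs j ∈ K (u j)) → Tendsto xs atTop (𝓝 x) →
          Tendsto (fun j ↦ ψs (u j) (xs j)) atTop (𝓝 (ψ x))) :
    TendstoInDistribution (fun n ↦ ψs n ∘ X n) atTop (ψ ∘ Z) P P' where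
  forall_aemeasurable n := (hψs n).comp_aemeasurable (hX.forall_aemeasurable n)
  aemeasurable_limit := hψ.comp_aemeasurable hX.aemeasurable_limit
  tendsto := by
    have key := tendsto_map_of_forall_exists_seq_tendsto (F' := F') hX.tendsto
      (fun n ↦ (hψs n).aemeasurable) hψ.aemeasurable fun ε hε ↦ by
        obtain ⟨K, hKm, hK, hgood⟩ := h ε hε
        refine ⟨K, hK.mono fun n hn ↦ ?_, ?_⟩
        · rw [ProbabilityMeasure.coe_mk,
            Measure.map_apply_of_aemeasurable (hX.forall_aemeasurable n) (hKm n).compl]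
          exact hn
        · rw [ProbabilityMeasure.coe_mk]
          exact hgood
    have h1 : ∀ n, (⟨(P n).map (ψs n ∘ X n), Measure.isProbabilityMeasure_map
          ((hψs n).comp_aemeasurable (hX.forall_aemeasurable n))⟩ : ProbabilityMeasure F') =
        ProbabilityMeasure.map
          (⟨(P n).map (X n), Measure.isProbabilityMeasure_map (hX.forall_aemeasurable n)⟩ :
            ProbabilityMeasure E) (hψs n).aemeasurable := fun n ↦ by
      apply ProbabilityMeasure.toMeasure_injective
      rw [ProbabilityMeasure.toMeasure_map, ProbabilityMeasure.coe_mk, ProbabilityMeasure.coe_mk,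
        AEMeasurable.map_map_of_aemeasurable (hψs n).aemeasurable (hX.forall_aemeasurable n)]
    have h2 : (⟨P'.map (ψ ∘ Z), Measure.isProbabilityMeasure_map
          (hψ.comp_aemeasurable hX.aemeasurable_limit)⟩ : ProbabilityMeasure F') =
        ProbabilityMeasure.map
          (⟨P'.map Z, Measure.isProbabilityMeasure_map hX.aemeasurable_limit⟩ :
            ProbabilityMeasure E) hψ.aemeasurable := by
      apply ProbabilityMeasure.toMeasure_injective
      rw [ProbabilityMeasure.toMeasure_map, ProbabilityMeasure.coe_mk, ProbabilityMeasure.coe_mk,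
        AEMeasurable.map_map_of_aemeasurable hψ.aemeasurable hX.aemeasurable_limit]
    convert key using 1
    · funext n
      exact h1 n
    · rw [h2]

omit [OpensMeasurableSpace F'] in
/-- **Joint form**: under the hypotheses of
`tendstoInDistribution_comp_of_forall_exists_seq_tendsto`, `(X n, ψs n (X n)) → (Z, ψ Z)` in
distribution. [folklore] -/
theorem tendstoInDistribution_prodMk_comp_of_forall_exists_seq_tendsto
    [OpensMeasurableSpace (E × F')]
    (hX : TendstoInDistribution X atTop Z P P') {ψs : ℕ → E → F'} {ψ : E → F'}
    (hψs : ∀ n, Measurable (ψs n)) (hψ : Measurable ψ)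
    (h : ∀ ε : ℝ≥0∞, 0 < ε → ∃ K : ℕ → Set E, (∀ n, MeasurableSet (K n)) ∧
      (∀ᶠ n in atTop, P n (X n ⁻¹' (K n)ᶜ) ≤ ε) ∧
      ∀ᵐ x ∂(P'.map Z), ∀ u : ℕ → ℕ, StrictMono u → ∀ xs : ℕ → E,
        (∀ j, xs j ∈ K (u j)) → Tendsto xs atTop (𝓝 x) →
          Tendsto (fun j ↦ ψs (u j) (xs j)) atTop (𝓝 (ψ x))) :
    TendstoInDistribution (fun n ω ↦ (X n ω, ψs n (X n ω))) atTop (fun ω ↦ (Z ω, ψ (Z ω)))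
      P P' :=
  tendstoInDistribution_comp_of_forall_exists_seq_tendsto (F' := E × F') hX
    (fun n ↦ measurable_id.prodMk (hψs n)) (measurable_id.prodMk hψ) fun ε hε ↦ by
      obtain ⟨K, hKm, hK, hgood⟩ := h ε hε
      refine ⟨K, hKm, hK, hgood.mono fun x hx u hu xs hxs hlim ↦ ?_⟩
      exact hlim.prodMk_nhds (hx u hu xs hxs hlim)

end InDistribution

/-! ### Support transfer along varying good sets -/

section Support

variable {μs : ℕ → ProbabilityMeasure E} {μ : ProbabilityMeasure E}

omit [MeasurableSpace E] [OpensMeasurableSpace E] in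
/-- The tails `closure ⋃_{n ≥ m} K n` decrease, and their intersection consists of limits of
good sequences: `x ∈ ⋂_m closure ⋃_{n ≥ m} K n` iff-ish there are `u` strictly increasing and
`xs j ∈ K (u j)` with `xs j → x` (the "if" direction, used below, is
`exists_strictMono_seq_tendsto_of_forall_mem_closure`; here the converse inclusion). [folklore] -/
theorem mem_iInter_closure_tail_of_seq_tendsto {K : ℕ → Set E} {x : E} {u : ℕ → ℕ}
    (hu : StrictMono u) {xs : ℕ → E} (hxs : ∀ j, xs j ∈ K (u j))
    (hlim : Tendsto xs atTop (𝓝 x)) : x ∈ ⋂ m, closure (⋃ n, ⋃ (_ : m ≤ n), K n) := by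
  refine mem_iInter.2 fun m ↦ mem_closure_of_tendsto hlim ?_
  filter_upwards [eventually_ge_atTop m] with j hj
  exact mem_iUnion₂.2 ⟨u j, hj.trans (hu.id_le j), hxs j⟩

/-- **Support transfer to weak limits along varying good sets.** Let `μs n → μ` weakly on a
pseudo-emetric space. If for every `ε > 0` there are sets `K n` with `μs n (K n)ᶜ ≤ ε`
eventually, such that every limit `x` of a good sequence (`xs j ∈ K (u j)`, `u` strictly
increasing, `xs j → x`) lies in `G`, then `μ Gᶜ = 0`. (With `K n = F` closed this is
`measure_compl_eq_zero_of_forall_exists_isClosed_subset` of `AlmostContinuousMapping.lean`; the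
varying form is the one needed when the approximating random curves live in approximating
domains, Kemppainen–Smirnov 2017, Cor. 1.8.) Proof: the closed tails
`A_m = closure ⋃_{n ≥ m} K n` have `μs n (A_m)ᶜ ≤ ε` for large `n`, so `μ (A_m)ᶜ ≤ ε`
(portmanteau, open sets), `μ (⋂ A_m)ᶜ ≤ ε` (continuity from below), and `⋂ A_m ⊆ G` by the
diagonal lemma. [folklore] -/
theorem measure_compl_eq_zero_of_forall_exists_seq_limits (hlim : Tendsto μs atTop (𝓝 μ))
    {G : Set E}
    (h : ∀ ε : ℝ≥0∞, 0 < ε → ∃ K : ℕ → Set E,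
      (∀ᶠ n in atTop, (μs n : Measure E) (K n)ᶜ ≤ ε) ∧
      ∀ x : E, (∃ u : ℕ → ℕ, StrictMono u ∧ ∃ xs : ℕ → E, (∀ j, xs j ∈ K (u j)) ∧
        Tendsto xs atTop (𝓝 x)) → x ∈ G) :
    (μ : Measure E) Gᶜ = 0 := by
  refine nonpos_iff_eq_zero.1 (ENNReal.le_of_forall_pos_le_add fun ε hε _ ↦ ?_)
  rw [zero_add]
  obtain ⟨K, hK, hgood⟩ := h ε (by exact_mod_cast hε)
  set A : ℕ → Set E := fun m ↦ closure (⋃ n, ⋃ (_ : m ≤ n), K n) with hA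
  have hAclosed : ∀ m, IsClosed (A m) := fun m ↦ isClosed_closure
  have hKA : ∀ {m n : ℕ}, m ≤ n → K n ⊆ A m := fun {m n} hmn ↦
    (subset_iUnion₂ (s := fun n (_ : m ≤ n) ↦ K n) n hmn).trans subset_closure
  -- `μ (A m)ᶜ ≤ ε` for every `m`
  have h1 : ∀ m, (μ : Measure E) (A m)ᶜ ≤ ε := by
    intro m
    refine measure_le_of_isOpen_of_frequently_le hlim (hAclosed m).isOpen_compl
      (Eventually.frequently ?_)
    filter_upwards [hK, eventually_ge_atTop m] with n hn hmn
    exact (measure_mono (compl_subset_compl.2 (hKA hmn))).trans hn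
  -- continuity from below along the increasing open sets `(A m)ᶜ`
  have hmono : Monotone fun m ↦ (A m)ᶜ := fun m m' hmm' ↦ compl_subset_compl.2
    (closure_mono (iUnion₂_subset fun n hn ↦
      subset_iUnion₂ (s := fun n (_ : m ≤ n) ↦ K n) n (hmm'.trans hn)))
  have h2 : (μ : Measure E) (⋃ m, (A m)ᶜ) ≤ ε := by
    have ht : Tendsto (fun m ↦ (μ : Measure E) (A m)ᶜ) atTop (𝓝 ((μ : Measure E) (⋃ m, (A m)ᶜ))) :=
      tendsto_measure_iUnion_atTop hmono
    exact le_of_tendsto' ht h1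
  -- `Gᶜ ⊆ ⋃ (A m)ᶜ` by the diagonal lemma
  have h3 : Gᶜ ⊆ ⋃ m, (A m)ᶜ := by
    intro x hx
    rw [← compl_iInter, mem_compl_iff]
    intro hxA
    obtain ⟨u, xs, hu, hxs, hxlim⟩ :=
      exists_strictMono_seq_tendsto_of_forall_mem_closure (S := K) (mem_iInter.1 hxA)
    exact hx (hgood x ⟨u, hu, xs, hxs, hxlim⟩)
  exact (measure_mono h3).trans h2

/-- **Support transfer along varying good sets, a.e. form.** [folklore] -/
theorem ae_mem_of_forall_exists_seq_limits (hlim : Tendsto μs atTop (𝓝 μ)) {G : Set E}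
    (h : ∀ ε : ℝ≥0∞, 0 < ε → ∃ K : ℕ → Set E,
      (∀ᶠ n in atTop, (μs n : Measure E) (K n)ᶜ ≤ ε) ∧
      ∀ x : E, (∃ u : ℕ → ℕ, StrictMono u ∧ ∃ xs : ℕ → E, (∀ j, xs j ∈ K (u j)) ∧
        Tendsto xs atTop (𝓝 x)) → x ∈ G) :
    ∀ᵐ x ∂(μ : Measure E), x ∈ G :=
  measure_compl_eq_zero_of_forall_exists_seq_limits hlim h

/-- **Support transfer along varying good sets, for limits in distribution.** If `X n → Z` in
distribution and for every `ε > 0` there are measurable `K n` with `P n (X n ∉ K n) ≤ ε`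
eventually such that limits of good sequences lie in `G`, then `Z ∈ G` almost surely. [folklore] -/
theorem ae_mem_of_tendstoInDistribution_of_forall_exists_seq_limits
    {Ω : ℕ → Type*} {mΩ : ∀ n, MeasurableSpace (Ω n)} {P : ∀ n, Measure (Ω n)}
    [∀ n, IsProbabilityMeasure (P n)] {Ω' : Type*} {mΩ' : MeasurableSpace Ω'} {P' : Measure Ω'}
    [IsProbabilityMeasure P'] {X : ∀ n, Ω n → E} {Z : Ω' → E}
    (hX : TendstoInDistribution X atTop Z P P') {G : Set E}
    (h : ∀ ε : ℝ≥0∞, 0 < ε → ∃ K : ℕ → Set E, (∀ n, MeasurableSet (K n)) ∧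
      (∀ᶠ n in atTop, P n (X n ⁻¹' (K n)ᶜ) ≤ ε) ∧
      ∀ x : E, (∃ u : ℕ → ℕ, StrictMono u ∧ ∃ xs : ℕ → E, (∀ j, xs j ∈ K (u j)) ∧
        Tendsto xs atTop (𝓝 x)) → x ∈ G) :
    ∀ᵐ ω ∂P', Z ω ∈ G := by
  have hmain := measure_compl_eq_zero_of_forall_exists_seq_limits hX.tendsto (G := G)
    fun ε hε ↦ by
      obtain ⟨K, hKm, hK, hgood⟩ := h ε hε
      refine ⟨K, hK.mono fun n hn ↦ ?_, hgood⟩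
      rw [ProbabilityMeasure.coe_mk,
        Measure.map_apply_of_aemeasurable (hX.forall_aemeasurable n) (hKm n).compl]
      exact hn
  have hle : P' (Z ⁻¹' Gᶜ) ≤ (P'.map Z) Gᶜ := Measure.le_map_apply hX.aemeasurable_limit _
  have h0 : P' (Z ⁻¹' Gᶜ) = 0 := nonpos_iff_eq_zero.1 (hle.trans (le_of_eq hmain))
  exact h0

end Support

end Literature.Probability.Process
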